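import Literature.NumberTheory.EllipticCurves.PeriodLatticePresentationProofs
import Literature.NumberTheory.EllipticCurves.ManinConstantGamma1ModularDegree
import HarnessLib

/-!
# `Γ₁(N)`-invariant holomorphic extension of `℘_Λ(2πi∫f)·G` and its decay at the cusps (line `nsf` v21, stub S3-X `stub_x1Denominator`, part X-b; crux `StarOptBNSF`, stmt-BirchSwinnertonDyer-27047)

The `Γ₁(N)`-analogue of the tree's `exists_invariant_extension` / `isZeroAtImInfty_slash_of_presentation`
(`PeriodLatticePresentationProofs`, there for `Γ₀(N)` and a level-one denominator `Δ^a·∏…`).  Let `f ∈ S₂(Γ₀(N))`,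
`f ≠ 0`, `u = 2πi∫f`, and let `Λ = Λ(L) ⊇ Λ₁(f)` contain only the `Γ₁(N)`-PERIODS (so `x = ℘_Λ(u)` is `Γ₁(N)`- but not
`Γ₀(N)`-invariant — the `X₁(N)`-parametrisation situation of Stevens' optimal curve).

* `eichlerIntegral_gamma1_smul_mem_iff`, `weierstrassP_eichlerIntegral_gamma1_smul` — `u(γτ) = u(τ) + {∞,γ∞}_f` with
  `{∞,γ∞}_f ∈ Λ₁(f) ⊆ Λ` for `γ ∈ Γ₁(N)` (tree `eichlerIntegral_smul_sub_holds`, `cuspSymbol_mem_periodLatticeGamma1`).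
* `exists_invariant_extension_gamma1` — for `G : ℍ → ℂ` holomorphic with `G(γτ) = (cτ+d)^K G(τ)` (`γ ∈ Γ₁(N)`, `K ∈ ℤ`)
  killing the poles of `x` (non-negative order of `x·G`), the meromorphic normal form of `x·G` is a holomorphic `F : ℍ → ℂ`,
  `Γ₁(N)`-invariant of weight `K`, equal to `℘_Λ(u)G` off the poles (Riemann + identity theorem, verbatim pattern of the tree).
* `isZeroAtImInfty_slash_of_presentation_mul_pow` — if `℘_Λ(u)·(G₁·f^a) = F` off the poles with `G₁ ∈ S_{k₁}(Γ₀(N))` and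
  `a ≥ 2m_A + 1` (`m_A` = order at `q_N = 0` of `V_{f∣A}`), then `F∣[k₁ + 2a]A → 0` at `i∞`: high in the cusp
  `(F∣A)(τ) = [℘_Λ(C_A + V_{f∣A}(τ))·(f∣[2]A)(τ)^a]·(G₁∣[k₁]A)(τ)` and the bracket tends to `0` (tree
  `IsCuspFunction.tendsto_weierstrassP_mul_pow_atImInfty` with `D = f∣[2]A`, a cuspidal `q_N`-series by `isCuspFunction_slash`).
Nothing here reads `r_an`; BSD is not proved by this file.
-/

set_option linter.dupNamespace false
set_option autoImplicit false

noncomputable section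

open Complex Filter Topology Set Function
open UpperHalfPlane hiding I
open scoped Real Topology Manifold MatrixGroups PeriodPair ModularForm
open ModularForm CongruenceSubgroup

open Literature.NumberTheory.EllipticCurves Literature.NumberTheory.EllipticCurves.ModularForms

namespace Summit.BirchSwinnertonDyer.BirchSwinnertonDyer.Theorems.DepletionAtTwo.X1Transfer

variable {N : ℕ} [NeZero N]

/-! ### `Γ₁(N)`-invariance of `℘_Λ(u)` for `Λ ⊇ Λ₁(f)` -/

/-- For `γ ∈ Γ₁(N)`: `u(γτ) − u(τ) ∈ Λ` when `Λ ⊇ Λ₁(f)`. [cite: Manin1972, Prop. 1.4] -/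
theorem eichlerIntegral_gamma1_smul_sub_mem (f : CuspForm (Gamma0 N) 2) (L : PeriodPair)
    (hΛ : ∀ x ∈ periodLatticeGamma1 f, x ∈ L.lattice) {γ : SL(2, ℤ)} (hγ : γ ∈ Gamma1 N) (τ : ℍ) :
    eichlerIntegral f (γ • τ) - eichlerIntegral f τ ∈ L.lattice := by
  have h := eichlerIntegral_smul_sub_holds f ⟨γ, Gamma1_in_Gamma0 N hγ⟩ τ
  rw [Subgroup.coe_mk] at h
  rw [h]
  exact hΛ _ (cuspSymbol_mem_periodLatticeGamma1 f ⟨γ, hγ⟩)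

/-- For `γ ∈ Γ₁(N)` and `Λ ⊇ Λ₁(f)`: `u(γτ) ∈ Λ ↔ u(τ) ∈ Λ`. [folklore] -/
theorem eichlerIntegral_gamma1_smul_mem_iff (f : CuspForm (Gamma0 N) 2) (L : PeriodPair)
    (hΛ : ∀ x ∈ periodLatticeGamma1 f, x ∈ L.lattice) {γ : SL(2, ℤ)} (hγ : γ ∈ Gamma1 N) (τ : ℍ) :
    eichlerIntegral f (γ • τ) ∈ L.lattice ↔ eichlerIntegral f τ ∈ L.lattice := by
  have h := eichlerIntegral_gamma1_smul_sub_mem f L hΛ hγ τ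
  constructor
  · intro h1; simpa using sub_mem h1 h
  · intro h1; simpa using add_mem h h1

/-- For `γ ∈ Γ₁(N)` and `Λ ⊇ Λ₁(f)`: `℘_Λ(u(γτ)) = ℘_Λ(u(τ))`. [cite: Manin1972, Prop. 1.4] -/
theorem weierstrassP_eichlerIntegral_gamma1_smul (f : CuspForm (Gamma0 N) 2) (L : PeriodPair)
    (hΛ : ∀ x ∈ periodLatticeGamma1 f, x ∈ L.lattice) {γ : SL(2, ℤ)} (hγ : γ ∈ Gamma1 N) (τ : ℍ) :
    ℘[L] (eichlerIntegral f (γ • τ)) = ℘[L] (eichlerIntegral f τ) := by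
  have hmem := eichlerIntegral_gamma1_smul_sub_mem f L hΛ hγ τ
  have := L.weierstrassP_add_coe (eichlerIntegral f τ) ⟨_, hmem⟩
  rwa [add_sub_cancel] at this

/-! ### The holomorphic, `Γ₁(N)`-invariant extension of `x·G` -/

/-- **Removable singularities and `Γ₁(N)`-invariance.** Let `Λ ⊇ Λ₁(f)`, `f ≠ 0`, `K ∈ ℤ`, and let `G : ℍ → ℂ` be
holomorphic with `G(γτ) = (cτ + d)^K G(τ)` for all `γ ∈ Γ₁(N)`, such that at every pole `w` of `X = ℘_Λ ∘ u` the product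
`X·(G ∘ ofComplex)` has non-negative order.  Then there is a holomorphic `F : ℍ → ℂ`, invariant of weight `K` under `Γ₁(N)`,
with `F(τ) = ℘_Λ(u(τ))G(τ)` off the poles (normal form; identity theorem). [folklore] -/
theorem exists_invariant_extension_gamma1 (f : CuspForm (Gamma0 N) 2) (hf : f ≠ 0) (L : PeriodPair)
    (hΛ : ∀ x ∈ periodLatticeGamma1 f, x ∈ L.lattice) (G : ℍ → ℂ) (K : ℤ)
    (hGan : AnalyticOnNhd ℂ (G ∘ ofComplex) {z : ℂ | 0 < z.im})
    (hGsmul : ∀ (γ : SL(2, ℤ)), γ ∈ Gamma1 N → ∀ τ : ℍ, G (γ • τ) = denom γ τ ^ K * G τ)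
    (hkill : ∀ z : ℂ, 0 < z.im → eichlerIntegral f (ofComplex z) ∈ L.lattice →
      0 ≤ meromorphicOrderAt ((fun w : ℂ ↦ ℘[L] (eichlerIntegral f (ofComplex w))) *
        (G ∘ ofComplex)) z) :
    ∃ F : ℍ → ℂ, MDifferentiable 𝓘(ℂ) 𝓘(ℂ) F ∧
      (∀ γ : SL(2, ℤ), γ ∈ Gamma1 N → F ∣[K] γ = F) ∧
      ∀ τ : ℍ, eichlerIntegral f τ ∉ L.lattice → ℘[L] (eichlerIntegral f τ) * G τ = F τ := by
  set U : ℂ → ℂ := fun w ↦ eichlerIntegral f (ofComplex w) with hU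
  set X : ℂ → ℂ := fun w ↦ ℘[L] (eichlerIntegral f (ofComplex w)) with hX
  set Gc : ℂ → ℂ := G ∘ ofComplex with hGc
  set H : Set ℂ := {z : ℂ | 0 < z.im} with hH
  have hXm : ∀ z ∈ H, MeromorphicAt X z := fun z hz ↦
    meromorphicAt_weierstrassP_eichlerIntegral f L hz
  have hXG : MeromorphicOn (X * Gc) H := fun z hz ↦ (hXm z hz).mul (hGan z hz).meromorphicAt
  have hXan : ∀ z ∈ H, U z ∉ L.lattice → AnalyticAt ℂ X z := fun z hz hzL ↦
    analyticOnNhd_weierstrassP_eichlerIntegral f L z ⟨hz, hzL⟩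
  have hord : ∀ z ∈ H, 0 ≤ meromorphicOrderAt (X * Gc) z := by
    intro z hz
    by_cases hzL : U z ∈ L.lattice
    · exact hkill z hz hzL
    · exact meromorphicOrderAt_mul_nonneg_of_analyticAt (hXan z hz hzL) (hGan z hz)
  set Fc : ℂ → ℂ := toMeromorphicNFOn (X * Gc) H with hFc
  have hFan : AnalyticOnNhd ℂ Fc H := fun z hz ↦ analyticAt_toMeromorphicNFOn hXG hz (hord z hz)
  have hFeq : ∀ z ∈ H, U z ∉ L.lattice → Fc z = X z * Gc z := fun z hz hzL ↦
    toMeromorphicNFOn_apply_of_analyticAt hXG hz ((hXan z hz hzL).mul (hGan z hz))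
  -- invariance of `Fc` on the half-plane
  have hinv : ∀ γ : SL(2, ℤ), γ ∈ Gamma1 N → ∀ z ∈ H,
      Fc (moebius γ z) = ((γ 1 0 : ℤ) * z + (γ 1 1 : ℤ)) ^ K * Fc z := by
    intro γ hγ
    have hA : AnalyticOnNhd ℂ (Fc ∘ moebius γ) H := fun z hz ↦
      (hFan (moebius γ z) (moebius_im_pos γ hz)).comp (analyticAt_moebius γ hz)
    have hB : AnalyticOnNhd ℂ (fun z ↦ ((γ 1 0 : ℤ) * z + (γ 1 1 : ℤ)) ^ K * Fc z) H := by
      intro z hz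
      have hlin : AnalyticAt ℂ (fun z : ℂ ↦ ((γ 1 0 : ℤ) : ℂ) * z + (γ 1 1 : ℤ)) z :=
        (analyticAt_const.mul analyticAt_id).add analyticAt_const
      exact (hlin.zpow (moebius_denom_ne_zero γ hz)).mul (hFan z hz)
    have hagree : ∀ z ∈ H, U z ∉ L.lattice →
        (Fc ∘ moebius γ) z = ((γ 1 0 : ℤ) * z + (γ 1 1 : ℤ)) ^ K * Fc z := by
      intro z hz hzL
      have hz' : 0 < (moebius γ z).im := moebius_im_pos γ hz
      have hzL' : U (moebius γ z) ∉ L.lattice := by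
        simp only [hU]
        rw [← smul_ofComplex γ hz]
        exact fun h ↦ hzL ((eichlerIntegral_gamma1_smul_mem_iff f L hΛ hγ (ofComplex z)).mp h)
      rw [comp_apply, hFeq _ hz' hzL', hFeq z hz hzL]
      have hXeq : X (moebius γ z) = X z := by
        simp only [hX]
        rw [← smul_ofComplex γ hz]
        exact weierstrassP_eichlerIntegral_gamma1_smul f L hΛ hγ (ofComplex z)
      have hGeq : Gc (moebius γ z) = ((γ 1 0 : ℤ) * z + (γ 1 1 : ℤ)) ^ K * Gc z := by
        simp only [hGc, comp_apply]
        rw [← smul_ofComplex γ hz, hGsmul γ hγ (ofComplex z), denom_ofComplex γ hz]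
      rw [hXeq, hGeq]
      ring
    obtain ⟨z₀, hz₀⟩ := nonempty_diff_of_countable (countable_setOf_eichlerIntegral_mem_lattice f L hf)
    have hz₀H : z₀ ∈ H := hz₀.1
    have hz₀L : U z₀ ∉ L.lattice := fun h ↦ hz₀.2 ⟨hz₀.1, h⟩
    have hev : (Fc ∘ moebius γ) =ᶠ[𝓝 z₀] fun z ↦ ((γ 1 0 : ℤ) * z + (γ 1 1 : ℤ)) ^ K * Fc z := by
      filter_upwards [(isOpen_setOf_eichlerIntegral_notMem_lattice f L).mem_nhds ⟨hz₀H, hz₀L⟩]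
        with z hz
      exact hagree z hz.1 hz.2
    have heq := hA.eqOn_of_preconnected_of_eventuallyEq hB convex_setOf_im_pos.isPreconnected
      hz₀H hev
    intro z hz
    exact heq hz
  refine ⟨fun τ : ℍ ↦ Fc τ, ?_, ?_, ?_⟩
  · rw [UpperHalfPlane.mdifferentiable_iff]
    refine hFan.differentiableOn.congr fun z hz ↦ ?_
    simp only [comp_apply, ofComplex_apply_of_im_pos hz, UpperHalfPlane.coe_mk]
  · intro γ hγ
    funext τ
    have hd : denom γ τ = (γ 1 0 : ℤ) * (τ : ℂ) + (γ 1 1 : ℤ) := by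
      rw [← denom_ofComplex γ τ.im_pos, ofComplex_apply]
    have hd0 : denom γ τ ≠ 0 := denom_ne_zero γ τ
    have h1 : ((γ • τ : ℍ) : ℂ) = moebius γ τ := by
      rw [← coe_smul_ofComplex γ τ.im_pos, ofComplex_apply]
    rw [ModularForm.SL_slash_apply]
    show Fc ((γ • τ : ℍ) : ℂ) * denom γ τ ^ (-K) = Fc τ
    rw [h1, hinv γ hγ τ τ.im_pos, ← hd, zpow_neg, mul_comm (denom γ τ ^ K) _, mul_assoc,
      mul_inv_cancel₀ (zpow_ne_zero _ hd0), mul_one]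
  · intro τ hτ
    show ℘[L] (eichlerIntegral f τ) * G τ = Fc τ
    have := hFeq τ τ.im_pos (by simpa [hU, ofComplex_apply] using hτ)
    rw [this]
    simp [hX, hGc, ofComplex_apply]

/-! ### Behaviour at the cusps -/

/-- **Vanishing at the cusp `A∞`.** Suppose `℘_Λ(u)·(G₁·f^a) = F` off the poles with `G₁ ∈ S_{k₁}(Γ₀(N))`, and
`a ≥ 2m_A + 1` where `m_A` is the order at `q_N = 0` of the `q`-expansion of `V_{f∣A} = 2πi∫(f ∣[2] A)`.  Then
`F ∣[k₁ + 2a] A` tends to `0` at `i∞`: high in the cusp,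
`(F ∣ A)(τ) = ℘_Λ(C_A + V_{f∣A}(τ))·(f∣[2]A)(τ)^a·(G₁∣[k₁]A)(τ)` and the first two factors together tend to `0`
(`IsCuspFunction.tendsto_weierstrassP_mul_pow_atImInfty` with the cuspidal `q_N`-series `D = f∣[2]A`). [folklore] -/
theorem isZeroAtImInfty_slash_of_presentation_mul_pow (f : CuspForm (Gamma0 N) 2) (hf : f ≠ 0)
    (L : PeriodPair) (F : ℍ → ℂ) {k₁ : ℤ} (G₁ : CuspForm (Gamma0 N) k₁) (a : ℕ) (A : SL(2, ℤ))
    (hFG : ∀ τ : ℍ, eichlerIntegral f τ ∉ L.lattice →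
      ℘[L] (eichlerIntegral f τ) * (G₁ τ * f τ ^ a) = F τ)
    (ha : 2 * analyticOrderNatAt (cuspFunction N (verticalIntegral (⇑f ∣[(2 : ℤ)] A))) 0 + 1 ≤ a) :
    IsZeroAtImInfty (F ∣[k₁ + 2 * (a : ℤ)] A) := by
  obtain ⟨C, hC⟩ := exists_eichlerIntegral_smul_eq f A
  obtain ⟨T, hT⟩ := exists_forall_eichlerIntegral_smul_notMem f hf L A
  have hV := isCuspFunction_verticalIntegral_slash f A
  have hV0 := verticalIntegral_slash_ne_zero f hf A
  have hD := isCuspFunction_slash (k := 2) f A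
  have hG : Tendsto ((⇑G₁) ∣[k₁] A) atImInfty (𝓝 0) := CuspFormClass.zero_at_infty_slash G₁ A
  have hlim := (hV.tendsto_weierstrassP_mul_pow_atImInfty hV0 hD L C ha).mul hG
  rw [zero_mul] at hlim
  have hmem : {τ : ℍ | T ≤ τ.im} ∈ atImInfty := (atImInfty_mem _).mpr ⟨T, fun _ h ↦ h⟩
  refine (hlim.congr' ?_ : Tendsto (F ∣[k₁ + 2 * (a : ℤ)] A) atImInfty (𝓝 0))
  filter_upwards [hmem] with τ hτ
  have hd0 : denom A τ ≠ 0 := denom_ne_zero A τ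
  simp only [ModularForm.SL_slash_apply]
  rw [← hFG (A • τ) (hT τ hτ), hC τ,
    show -(k₁ + 2 * (a : ℤ)) = -k₁ + (-2 : ℤ) * a by ring, zpow_add₀ hd0, zpow_mul, zpow_natCast, mul_pow]
  ring

end Summit.BirchSwinnertonDyer.BirchSwinnertonDyer.Theorems.DepletionAtTwo.X1Transfer

end
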